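import Mathlib
import Literature.NumberTheory.NumberFields.PureCubicGenusDivisor
import Summits.QuantumAdvantage.QuantumAdvantage.Theorems.LinnikCubicClassGroupsPureCubicClassNumberHardHonda8
import Summits.QuantumAdvantage.QuantumAdvantage.Theorems.LinnikCubicClassGroupsPureCubicClassNumberHardHonda25Prime
import HarnessLib

/-!
# Honda's criterion for a prime radicand: `3 ∣ h(ℚ(∛p)) ⟺ p ≡ 1 (mod 3)`

Route `LinnikCubicClassGroups` (rank-0 hypothesis-type target `PureCubicClassNumberHard`,
stmt-QuantumAdvantage-11826); the classical arithmetic of the fields `ℚ(∛m)` whose class numbers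
the booked theorem `pureCubicClassNumber_lowBits_mem_FBQP` computes.

> T. Honda, *Pure cubic fields whose class numbers are multiples of three*, J. Number Theory 3
> (1971) 7–12, Theorem: the class number of `ℚ(∛m)` (`m` cube-free) is divisible by `3` unless
> `m` is one of `3`, `p^a`, `3p^a·…`, `p^a q^b` with primes `p, q ≡ 2 (mod 3)` subject to
> congruences modulo `9` ([AouissiMayerIsmailiTalbiAzizi2020, Thm. 2.3]: `3 ∤ h` iff the conductor
> of `ℚ(∛m, ζ₃)/ℚ(ζ₃)` is `9`, `q₁ ≡ 8 (9)`, `3q₁`, `9q₁` or `q₁q₂` with `qⱼ ≡ 2, 5 (9)`).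

For a PRIME radicand this reads: **`3 ∣ h(K)` for a (every) cubic number field `K ∋ ∛p` if and
only if `p ≡ 1 (mod 3)`** (`p ≠ 3`).  All three ingredients are theorems of the tree:
`p ≡ 1 (mod 3) ⟹ 3 ∣ h` is genus theory (`Honda1971.three_dvd_classNumber_of_padicValNat_eq_one`,
the unramified cyclic cubic extension `K·ℚ(ζ_p)⁺₃/K` and the Artin map), `p ≡ 8 (mod 9) ⟹ 3 ∤ h`
is `honda8` and `p ≡ 2, 5 (mod 9) ⟹ 3 ∤ h` is `honda25_prime` (Chevalley's ambiguous classes in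
`K(ζ₃)/ℚ(ζ₃)`).

* `three_dvd_classNumber_iff_of_prime` — the criterion;
* `not_three_dvd_classNumber_of_prime_mod_three` — the case `p ≡ 2 (mod 3)` alone.

HONEST FRAMING (block-2b rule): a kernel-checked classical theorem (Honda 1971) about class numbers
of pure cubic fields — an independent certification, NOT summit progress; the crux
`PureCubicClassNumberHard` is hypothesis-type and untouched.

## References
* T. Honda, *Pure cubic fields whose class numbers are multiples of three*, J. Number Theory 3
  (1971) 7–12, Theorem. [Honda1971]
* P. Barrucand, H. Cohn, *A rational genus, class number divisibility, and unit theory for pure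
  cubic fields*, J. Number Theory 2 (1970) 7–21. [BarrucandCohn1970]
* S. Aouissi, D. C. Mayer, M. C. Ismaili, M. Talbi, A. Azizi, Period. Math. Hungar. 81 (2020),
  Thm. 2.3. [AouissiMayerIsmailiTalbiAzizi2020]
-/

set_option linter.dupNamespace false

namespace Summit.QuantumAdvantage.QuantumAdvantage.Theorems.LinnikCubicClassGroups

open NumberField

/-- **`p ≡ 2 (mod 3)` prime ⟹ `3 ∤ h(K)`** for every cubic number field `K ∋ ∛p` (the union of
`honda8` and `honda25_prime`: `p ≡ 2 (mod 3)` means `p ≡ 2, 5, 8 (mod 9)`). [cite: Honda1971, Theorem] -/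
theorem not_three_dvd_classNumber_of_prime_mod_three (p : ℕ) (hp : p.Prime) (hp3 : p % 3 = 2)
    (K : Type) [Field K] [NumberField K] (hK : Module.finrank ℚ K = 3)
    (hα : ∃ α : K, α ^ 3 = (p : K)) : ¬ 3 ∣ classNumber K := by
  have h9 : p % 9 = 2 ∨ p % 9 = 5 ∨ p % 9 = 8 := by omega
  rcases h9 with h | h | h
  · exact honda25_prime p hp (Or.inl h) K hK hα
  · exact honda25_prime p hp (Or.inr h) K hK hα
  · exact honda8 p hp h K hK hα

/-- **Honda's criterion for a prime radicand** (Honda 1971, Theorem; Barrucand–Cohn 1970): for a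
prime `p ≠ 3` and every cubic number field `K` containing a cube root of `p` (all `≅ ℚ(∛p)`),
`3 ∣ h(K) ⟺ p ≡ 1 (mod 3)`. [cite: Honda1971, Theorem] [cite: AouissiMayerIsmailiTalbiAzizi2020, Thm. 2.3] -/
theorem three_dvd_classNumber_iff_of_prime (p : ℕ) (hp : p.Prime) (hp3 : p ≠ 3)
    (K : Type) [Field K] [NumberField K] (hK : Module.finrank ℚ K = 3)
    (hα : ∃ α : K, α ^ 3 = (p : K)) : 3 ∣ classNumber K ↔ p % 3 = 1 := by
  have hmod : p % 3 = 1 ∨ p % 3 = 2 := by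
    have h0 : p % 3 ≠ 0 := by
      intro h0
      have h3 : 3 ∣ p := Nat.dvd_of_mod_eq_zero h0
      exact hp3 ((Nat.prime_dvd_prime_iff_eq Nat.prime_three hp).mp h3).symm
    omega
  constructor
  · intro h3
    rcases hmod with h | h
    · exact h
    · exact absurd h3 (not_three_dvd_classNumber_of_prime_mod_three p hp h K hK hα)
  · intro h1
    obtain ⟨α, hα⟩ := hα
    haveI : Fact p.Prime := ⟨hp⟩
    exact Literature.NumberTheory.NumberFields.Honda1971.three_dvd_classNumber_of_padicValNat_eq_one
      hp h1 (by rw [padicValNat_self]) K hK α hα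

end Summit.QuantumAdvantage.QuantumAdvantage.Theorems.LinnikCubicClassGroups
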